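import Summits.CriticalPhenomena.PercolationContinuityZ3.Theorems.PercNearOneGluingNoHeavyLowerTailAntipodalR1Nested
import Literature.Probability.LatticeModels.RandomClusterFKG
import HarnessLib

/-!
# The nested-terminals injection preserves the grade `k(O) + k(K)`

Support file for `stmt-CriticalPhenomena-4575` (memos `prim-gen-kcluster/KCLUSTER-gen60.md` §4c,
`KCLUSTER-gen63.md` §4).  Continuation of `PercNearOneGluingNoHeavyLowerTailAntipodalR1Nested`: there the
map `x ↦ x' = x △ star(c)` was shown to inject `L = {b, c ∈ O_a ∖ K_a, K_a separates b | c}` into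
`R(b,c) = {b ∈ O_a ∖ K_a, c ∈ K_a ∖ O_a}` when `b ≁ c` and `N(c) ⊆ N(b)`.  Here we prove that it preserves
the GRADE `g(x) = k(O) + k(K)`, the total number of connected components of the open graph and of the
closed graph (vertex set `V`, finite), so that the graded statement ANTI₁-GRADED of `KCLUSTER-gen52` §3 —
the form that implies the refined row R1 for the random-cluster measures with `q ≥ 1` on the minors it
covers — holds on this class: for every `g`, `#{x ∈ L : g(x) = g} ≤ #{x ∈ R(b,c) : g(x) = g}`
(`AntipodalR1.card_lSet_filter_grade_le_of_nested`).  Also recorded: `L` is symmetric in the terminals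
(`AntipodalR1.lSet_comm`), `#R(b,c) = #R(c,b)` by the global colour swap (`AntipodalR1.card_rSet_comm`), hence
the ungraded inequality for either nesting `N(c) ⊆ N(b)` or `N(b) ⊆ N(c)`
(`AntipodalR1.card_lSet_le_card_rSet_of_nested'`).

Proof.  For `x ∈ L` every edge at `c` is open and every neighbour of `c` lies in `K_a`
(`AntipodalR1.nbr_of_apex_mem_clus`).  Hence the closed graph of `x'` is the closed graph of `x` with the
star of `c` added, `c` being isolated before and its neighbours lying in one component (that of `a`): the
first added edge merges two components, the others none, so `k(K') = k(K) - 1`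
(`AntipodalR1.card_cc_sup_star`, from the tree's one-edge lemmas
`Literature.Probability.LatticeModels.card_connectedComponent_sup_edge_lt` /
`…_le_sup_edge_add_one` / `…_sup_edge_of_reachable`).  Symmetrically the open graph of `x` is the open
graph of `x'` plus the star of `c`, with `c` isolated in the latter and its neighbours joined through `b`
(the edges `by`, `y ∈ N(c)`, are open and untouched), so `k(O) = k(O') - 1`.  Hence `g(x') = g(x)`.
The file is definition-free: the coloured graphs are written as `SimpleGraph.fromEdgeSet` of the set of
`Sym2`-edges carrying a label of the given colour.  [this work]
-/

namespace Summit.CriticalPhenomena.PercolationContinuityZ3.Theorems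

namespace AntipodalR1

open Finset Relation SimpleGraph

variable {V ι : Type*}

/-! ### Adding the star of an isolated vertex whose neighbours lie in one component -/

/-- **Star insertion.**  If `c` is isolated in `H₀`, `T` is a nonempty finite set of vertices not containing
`c`, pairwise joined in `H₀`, then adding the edges `c y`, `y ∈ T`, lowers the number of connected
components by exactly one. [this work] -/
theorem card_cc_sup_star [Finite V] [DecidableEq V] (H₀ : SimpleGraph V) (c : V) (T : Finset V)
    (hT : T.Nonempty) (hc : ∀ w, ¬ H₀.Adj c w) (hcT : c ∉ T)
    (hreach : ∀ y ∈ T, ∀ y' ∈ T, H₀.Reachable y y') :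
    Nat.card (H₀ ⊔ fromEdgeSet (↑(T.image fun y => s(c, y)) : Set (Sym2 V))).ConnectedComponent + 1 =
      Nat.card H₀.ConnectedComponent := by
  classical
  induction T using Finset.induction_on with
  | empty => exact absurd hT (by simp)
  | @insert y' T hy' ih =>
    have hcy' : c ≠ y' := fun h => hcT (h ▸ Finset.mem_insert_self _ _)
    have hsplit : H₀ ⊔ fromEdgeSet (↑((insert y' T).image fun y => s(c, y)) : Set (Sym2 V)) =
        (H₀ ⊔ fromEdgeSet (↑(T.image fun y => s(c, y)) : Set (Sym2 V))) ⊔ edge c y' := by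
      rw [Finset.image_insert, Finset.coe_insert, Set.insert_eq, fromEdgeSet_union, edge]
      ac_rfl
    rw [hsplit]
    by_cases hTe : T = ∅
    · subst hTe
      simp only [Finset.image_empty, Finset.coe_empty, fromEdgeSet_empty, sup_bot_eq]
      have hnr : ¬ H₀.Reachable c y' := by
        rintro ⟨p⟩
        cases p with
        | nil => exact hcy' rfl
        | cons h _ => exact hc _ h
      have h1 := Literature.Probability.LatticeModels.card_connectedComponent_sup_edge_lt H₀ hnr
      have h2 := Literature.Probability.LatticeModels.card_connectedComponent_le_sup_edge_add_one H₀ c y'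
      omega
    · have hTne : T.Nonempty := Finset.nonempty_iff_ne_empty.2 hTe
      have ih' := ih hTne (fun h => hcT (Finset.mem_insert_of_mem h))
        (fun y hy z hz => hreach y (Finset.mem_insert_of_mem hy) z (Finset.mem_insert_of_mem hz))
      set H₁ := H₀ ⊔ fromEdgeSet (↑(T.image fun y => s(c, y)) : Set (Sym2 V)) with hH₁
      obtain ⟨y, hy⟩ := hTne
      have hcy : c ≠ y := fun h => hcT (Finset.mem_insert_of_mem (h ▸ hy))
      have hr : H₁.Reachable c y' := by
        have h1 : H₁.Adj c y := by
          rw [hH₁, sup_adj, fromEdgeSet_adj]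
          exact Or.inr ⟨Finset.mem_coe.2 (Finset.mem_image_of_mem (fun y => s(c, y)) hy), hcy⟩
        have h2 : H₁.Reachable y y' :=
          (hreach y (Finset.mem_insert_of_mem hy) y' (Finset.mem_insert_self _ _)).mono le_sup_left
        exact h1.reachable.trans h2
      rw [Literature.Probability.LatticeModels.card_connectedComponent_sup_edge_of_reachable H₁ hr]
      exact ih'

/-! ### The two coloured graphs and the grade -/

section Graded

variable [Fintype V] [Fintype ι] [DecidableEq ι] {ends : ι → Sym2 V} {a b c : V}
  {x x' : ι → Bool}

omit [Fintype V] [Fintype ι] [DecidableEq ι] in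
/-- Membership in a coloured cluster gives reachability in the coloured graph. [this work] -/
theorem reachable_of_mem_clus {col : Bool} {v : V} (hv : v ∈ clus ends x col a) :
    (fromEdgeSet {s : Sym2 V | ∃ e, x e = col ∧ ends e = s}).Reachable a v := by
  rw [mem_clus] at hv
  induction hv with
  | refl => exact Reachable.refl _
  | @tail u w _ huw ih =>
    obtain ⟨e, hxe, he⟩ := huw
    by_cases huw' : u = w
    · exact huw' ▸ ih
    · have hadj : (fromEdgeSet {s : Sym2 V | ∃ e, x e = col ∧ ends e = s}).Adj u w := by
        rw [fromEdgeSet_adj]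
        exact ⟨⟨e, hxe, he⟩, huw'⟩
      exact ih.trans hadj.reachable

open Classical in
/-- **Grade preservation.**  For `x ∈ L` (with `b ≁ c`, `N(c) ⊆ N(b)`) and `x' = x △ star(c)`:
`k(O') = k(O) + 1` and `k(K') + 1 = k(K)`, hence `k(O') + k(K') = k(O) + k(K)`. [this work] -/
theorem grade_flipStar (hbc : ∀ e, ends e ≠ s(b, c))
    (hN : ∀ e y, ends e = s(c, y) → ∃ e', ends e' = s(b, y)) (hx : x ∈ lSet ends a b c)
    (hx' : ∀ e, x' e = if c ∈ ends e then !x e else x e) :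
    Nat.card (fromEdgeSet {s : Sym2 V | ∃ e, x' e = true ∧ ends e = s}).ConnectedComponent +
        Nat.card (fromEdgeSet {s : Sym2 V | ∃ e, x' e = false ∧ ends e = s}).ConnectedComponent =
      Nat.card (fromEdgeSet {s : Sym2 V | ∃ e, x e = true ∧ ends e = s}).ConnectedComponent +
        Nat.card (fromEdgeSet {s : Sym2 V | ∃ e, x e = false ∧ ends e = s}).ConnectedComponent := by
  classical
  obtain ⟨hbO, hbK, hcO, hcK, hreg⟩ := mem_lSet.1 hx
  have hac : a ≠ c := by
    rintro rfl
    exact hcK ReflTransGen.refl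
  have hbc' : b ≠ c := by
    rintro rfl
    exact hreg ReflTransGen.refl
  have key : ∀ {e : ι} {y : V}, ends e = s(c, y) → y ∈ clus ends x false a ∧ x e = true ∧ y ≠ c :=
    fun he => nbr_of_apex_mem_clus hbc hN hx he
  have hflip : ∀ {e : ι}, c ∈ ends e → x' e = !x e := fun hc => by rw [hx', if_pos hc]
  have hkeep : ∀ {e : ι}, c ∉ ends e → x' e = x e := fun hc => by rw [hx', if_neg hc]
  -- the neighbourhood of `c` and its star
  set T : Finset V := univ.filter fun y => ∃ e, ends e = s(c, y) with hTdef
  have hmemT : ∀ {y}, y ∈ T ↔ ∃ e, ends e = s(c, y) := by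
    intro y; simp [hTdef]
  have hTne : T.Nonempty := by
    rw [mem_clus] at hcO
    rcases (ReflTransGen.cases_tail_iff _ _ _).1 hcO with h | ⟨y, _, ⟨e, _, he⟩⟩
    · exact absurd h.symm hac
    · exact ⟨y, hmemT.2 ⟨e, by rw [he, Sym2.eq_swap]⟩⟩
  have hcT : c ∉ T := fun h => by
    obtain ⟨e, he⟩ := hmemT.1 h
    exact (key he).2.2 rfl
  -- membership of an edge `s(u,v)` in the star
  have hstar : ∀ {u v : V}, s(u, v) ∈ (↑(T.image fun y => s(c, y)) : Set (Sym2 V)) ↔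
      ∃ e, ends e = s(u, v) ∧ c ∈ ends e := by
    intro u v
    simp only [Finset.coe_image, Set.mem_image, Finset.mem_coe]
    constructor
    · rintro ⟨y, hy, hyuv⟩
      obtain ⟨e, he⟩ := hmemT.1 hy
      exact ⟨e, by rw [he, hyuv], by rw [he]; exact Sym2.mem_mk_left _ _⟩
    · rintro ⟨e, he, hc⟩
      obtain ⟨y, hey, -⟩ := eq_mk_of_mem he hc
      exact ⟨y, hmemT.2 ⟨e, hey⟩, by rw [← hey, he]⟩
  -- (K) the closed graph of `x'` is the closed graph of `x` plus the star of `c`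
  set GK : SimpleGraph V := fromEdgeSet {s : Sym2 V | ∃ e, x e = false ∧ ends e = s} with hGK
  have hK1 : fromEdgeSet {s : Sym2 V | ∃ e, x' e = false ∧ ends e = s} =
      GK ⊔ fromEdgeSet (↑(T.image fun y => s(c, y)) : Set (Sym2 V)) := by
    ext u v
    simp only [hGK, sup_adj, fromEdgeSet_adj, Set.mem_setOf_eq]
    rw [hstar]
    constructor
    · rintro ⟨⟨e, hxe, he⟩, huv⟩
      by_cases hc : c ∈ ends e
      · exact Or.inr ⟨⟨e, he, hc⟩, huv⟩
      · exact Or.inl ⟨⟨e, by rw [← hkeep hc, hxe], he⟩, huv⟩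
    · rintro (⟨⟨e, hxe, he⟩, huv⟩ | ⟨⟨e, he, hc⟩, huv⟩)
      · by_cases hc : c ∈ ends e
        · obtain ⟨y, hey, -⟩ := eq_mk_of_mem he hc
          have := (key hey).2.1
          rw [hxe] at this
          exact absurd this (by decide)
        · exact ⟨⟨e, by rw [hkeep hc, hxe], he⟩, huv⟩
      · obtain ⟨y, hey, -⟩ := eq_mk_of_mem he hc
        exact ⟨⟨e, by rw [hflip hc, (key hey).2.1]; rfl, he⟩, huv⟩
  have hK2 : ∀ w, ¬ GK.Adj c w := by
    intro w h
    rw [hGK, fromEdgeSet_adj, Set.mem_setOf_eq] at h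
    obtain ⟨⟨e, hxe, he⟩, -⟩ := h
    have := (key he).2.1
    rw [hxe] at this
    exact absurd this (by decide)
  have hK3 : ∀ y ∈ T, ∀ y' ∈ T, GK.Reachable y y' := by
    intro y hy y' hy'
    obtain ⟨e, he⟩ := hmemT.1 hy
    obtain ⟨e', he'⟩ := hmemT.1 hy'
    exact (reachable_of_mem_clus (key he).1).symm.trans (reachable_of_mem_clus (key he').1)
  have hK : Nat.card (fromEdgeSet {s : Sym2 V | ∃ e, x' e = false ∧ ends e = s}).ConnectedComponent + 1 =
      Nat.card GK.ConnectedComponent := by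
    rw [hK1]
    exact card_cc_sup_star GK c T hTne hK2 hcT hK3
  -- (O) the open graph of `x` is the open graph of `x'` plus the star of `c`
  set GO' : SimpleGraph V := fromEdgeSet {s : Sym2 V | ∃ e, x' e = true ∧ ends e = s} with hGO'
  have hO1 : fromEdgeSet {s : Sym2 V | ∃ e, x e = true ∧ ends e = s} =
      GO' ⊔ fromEdgeSet (↑(T.image fun y => s(c, y)) : Set (Sym2 V)) := by
    ext u v
    simp only [hGO', sup_adj, fromEdgeSet_adj, Set.mem_setOf_eq]
    rw [hstar]
    constructor
    · rintro ⟨⟨e, hxe, he⟩, huv⟩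
      by_cases hc : c ∈ ends e
      · exact Or.inr ⟨⟨e, he, hc⟩, huv⟩
      · exact Or.inl ⟨⟨e, by rw [hkeep hc, hxe], he⟩, huv⟩
    · rintro (⟨⟨e, hxe, he⟩, huv⟩ | ⟨⟨e, he, hc⟩, huv⟩)
      · by_cases hc : c ∈ ends e
        · rw [hflip hc] at hxe
          obtain ⟨y, hey, -⟩ := eq_mk_of_mem he hc
          have := (key hey).2.1
          rw [this] at hxe
          exact absurd hxe (by decide)
        · exact ⟨⟨e, by rw [← hkeep hc, hxe], he⟩, huv⟩
      · obtain ⟨y, hey, -⟩ := eq_mk_of_mem he hc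
        exact ⟨⟨e, (key hey).2.1, he⟩, huv⟩
  have hO2 : ∀ w, ¬ GO'.Adj c w := by
    intro w h
    rw [hGO', fromEdgeSet_adj, Set.mem_setOf_eq] at h
    obtain ⟨⟨e, hxe, he⟩, -⟩ := h
    have hc : c ∈ ends e := by rw [he]; exact Sym2.mem_mk_left _ _
    rw [hflip hc, (key he).2.1] at hxe
    exact absurd hxe (by decide)
  -- the edges `b y`, `y ∈ N(c)`, are open in `x'`
  have hby : ∀ {y : V}, y ∈ T → GO'.Adj y b := by
    intro y hy
    obtain ⟨e, he⟩ := hmemT.1 hy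
    obtain ⟨hyK, -, hyc⟩ := key he
    obtain ⟨e', he'⟩ := hN e y he
    have hyb : y ≠ b := by
      rintro rfl
      exact hbK hyK
    have hopen : x e' = true := by
      cases hxe : x e'
      · exact absurd (clus_step hyK ⟨e', hxe, by rw [he', Sym2.eq_swap]⟩) hbK
      · rfl
    have hce' : c ∉ ends e' := by
      rw [he', Sym2.mem_iff]
      rintro (rfl | rfl)
      · exact hbc' rfl
      · exact hyc rfl
    rw [hGO', fromEdgeSet_adj, Set.mem_setOf_eq]
    exact ⟨⟨e', by rw [hkeep hce', hopen], by rw [he', Sym2.eq_swap]⟩, hyb⟩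
  have hO3 : ∀ y ∈ T, ∀ y' ∈ T, GO'.Reachable y y' := fun y hy y' hy' =>
    (hby hy).reachable.trans (hby hy').reachable.symm
  have hO : Nat.card (fromEdgeSet {s : Sym2 V | ∃ e, x e = true ∧ ends e = s}).ConnectedComponent + 1 =
      Nat.card GO'.ConnectedComponent := by
    rw [hO1]
    exact card_cc_sup_star GO' c T hTne hO2 hcT hO3
  omega

open Classical in
/-- **ANTI₁-GRADED for nested terminal neighbourhoods.**  If `b ≁ c` and `N(c) ⊆ N(b)` then for every
grade `g`, `#{x ∈ L : k(O_x)+k(K_x) = g} ≤ #{x ∈ R(b,c) : k(O_x)+k(K_x) = g}` (the open / closed graphs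
being `fromEdgeSet` of the `Sym2`-edges carrying an open / closed label). [this work] -/
theorem card_lSet_filter_grade_le_of_nested (ends : ι → Sym2 V) {a b c : V}
    (hbc : ∀ e, ends e ≠ s(b, c)) (hN : ∀ e y, ends e = s(c, y) → ∃ e', ends e' = s(b, y)) (g : ℕ) :
    ((lSet ends a b c).filter fun x =>
        Nat.card (fromEdgeSet {s : Sym2 V | ∃ e, x e = true ∧ ends e = s}).ConnectedComponent +
          Nat.card (fromEdgeSet {s : Sym2 V | ∃ e, x e = false ∧ ends e = s}).ConnectedComponent = g).card ≤
      ((rSet ends a b c).filter fun x =>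
        Nat.card (fromEdgeSet {s : Sym2 V | ∃ e, x e = true ∧ ends e = s}).ConnectedComponent +
          Nat.card (fromEdgeSet {s : Sym2 V | ∃ e, x e = false ∧ ends e = s}).ConnectedComponent = g).card := by
  refine Finset.card_le_card_of_injOn (fun x e => if c ∈ ends e then !x e else x e) ?_ ?_
  · intro x hx
    rw [Finset.mem_coe, Finset.mem_filter] at hx
    obtain ⟨hxL, hxg⟩ := hx
    rw [Finset.mem_coe, Finset.mem_filter]
    refine ⟨flipStar_mem_rSet hbc hN hxL (x' := fun e => if c ∈ ends e then !x e else x e)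
      fun _ => rfl, ?_⟩
    rw [← hxg]
    exact grade_flipStar hbc hN hxL (x' := fun e => if c ∈ ends e then !x e else x e) fun _ => rfl
  · intro x _ y _ h
    funext e
    have he := congrFun h e
    by_cases hc : c ∈ ends e
    · simp only [hc, if_true] at he
      exact Bool.not_inj he
    · simpa only [hc, if_false] using he

/-! ### Symmetry in the two terminals -/

omit [Fintype V] in
/-- `L` is symmetric in the two terminals (separation by `K_a` is symmetric). [this work] -/
theorem lSet_comm (ends : ι → Sym2 V) (a b c : V) : lSet ends a b c = lSet ends a c b := by
  ext x
  rw [mem_lSet, mem_lSet]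
  constructor
  · rintro ⟨h1, h2, h3, h4, h5⟩
    exact ⟨h3, h4, h1, h2, fun h => h5 (region_symm h)⟩
  · rintro ⟨h1, h2, h3, h4, h5⟩
    exact ⟨h3, h4, h1, h2, fun h => h5 (region_symm h)⟩

omit [Fintype V] in
/-- The global colour swap exchanges `R(b,c)` and `R(c,b)`, so they have the same size. [this work] -/
theorem card_rSet_comm (ends : ι → Sym2 V) (a b c : V) :
    (rSet ends a b c).card = (rSet ends a c b).card := by
  refine Finset.card_bij (fun x _ => fun i => !x i) ?_ ?_ ?_
  · intro x hx
    obtain ⟨h1, h2, h3, h4⟩ := mem_rSet.1 hx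
    refine mem_rSet.2 ⟨?_, ?_, ?_, ?_⟩
    · rw [mem_clus_flip]; exact h3
    · rw [mem_clus_flip]; exact h4
    · rw [mem_clus_flip]; exact h1
    · rw [mem_clus_flip]; exact h2
  · intro x _ y _ h
    funext i
    have := congrFun h i
    exact Bool.not_inj this
  · intro y hy
    refine ⟨fun i => !y i, ?_, ?_⟩
    · obtain ⟨h1, h2, h3, h4⟩ := mem_rSet.1 hy
      refine mem_rSet.2 ⟨?_, ?_, ?_, ?_⟩
      · rw [mem_clus_flip]; exact h3
      · rw [mem_clus_flip]; exact h4
      · rw [mem_clus_flip]; exact h1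
      · rw [mem_clus_flip]; exact h2
    · funext i
      simp

omit [Fintype V] in
/-- **ANTI₁ for nested terminal neighbourhoods, either nesting** (ungraded): if `b ≁ c` and
`N(c) ⊆ N(b)` or `N(b) ⊆ N(c)`, then `#L ≤ #R(b,c)`. [this work] -/
theorem card_lSet_le_card_rSet_of_nested' (ends : ι → Sym2 V) {a b c : V}
    (hbc : ∀ e, ends e ≠ s(b, c))
    (hN : (∀ e y, ends e = s(c, y) → ∃ e', ends e' = s(b, y)) ∨
      (∀ e y, ends e = s(b, y) → ∃ e', ends e' = s(c, y))) :
    (lSet ends a b c).card ≤ (rSet ends a b c).card := by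
  rcases hN with hN | hN
  · exact card_lSet_le_card_rSet_of_nested ends hbc hN
  · have hcb : ∀ e, ends e ≠ s(c, b) := fun e h => hbc e (by rw [h, Sym2.eq_swap])
    rw [lSet_comm, card_rSet_comm]
    exact card_lSet_le_card_rSet_of_nested ends hcb hN

end Graded

end AntipodalR1

end Summit.CriticalPhenomena.PercolationContinuityZ3.Theorems
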